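/-
Origin: expansion seat `planner-pub-hodgecm-pv10-g3-0`, handover #2 2026-08-18T08:56:03Z (`HOME/pub-hodgecm-pv10-g3/lean/Pv10g3/StabilizerDescent.lean`, md5 a058a509, 131 lines);
landed by the gen-7 packager in gate run 27 as `HodgeCM/PerL34/StabilizerDescent.lean` (verbatim).
-/
/-
Copyright (c) 2026. All rights reserved.
Released under Apache 2.0 license as described in the file LICENSE.
-/
import Mathlib.Topology.Algebra.Group.Basic
import Mathlib.Topology.Algebra.Monoid
import Mathlib.Algebra.Group.Subgroup.Basic
import Mathlib.Tactic.Group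

/-!
# Descent of a fundamental set from an ambient group to a stabiliser

Pure topology / group theory (no number theory).  The situation is the last step of the classical
proof of the compactness criterion of Borel–Harish-Chandra / Mostow–Tamagawa / Godement for an
anisotropic group `G ⊆ GL_n` (Borel, *Introduction aux groupes arithmétiques* (1969), §8; Platonov–
Rapinchuk (1994), §4.4, §5.3): a **right action** `X × 𝒢 → X` of a topological group `𝒢`
(think `GL_n(𝔸)`), a point `x₀ ∈ X` (think: the matrix of a form) with **stabiliser** `G = Stab(x₀)`,
a subgroup `Γ ≤ 𝒢` (think `GL_n(K)`) moving `x₀` inside a subset `D ⊆ X` (think: rational matrices)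
which meets every compact set in a finite set (closed and discrete).  THEN a "Mahler-type"
containment `g ∈ C · Γ` (`C` compact) for the elements `g ∈ G` DESCENDS to `g ∈ C′ · (G ∩ Γ)` with
`C′ ⊆ G` compact: the finitely many points of `x₀ · C ∩ D` are reached from `x₀` by finitely many
`γᵢ⁻¹ ∈ Γ`, and `C′ = G ∩ ⋃ᵢ C γᵢ`.

Main definitions / results (namespace `HodgeCM.PerL34.StabilizerDescent`):

* `RightActionData 𝒢 X` — a right action given by bare functions (`act`, `act_mul`, `act_one`), so
  that instances on concrete matrix groups need not be registered;
* `RightActionData.stabilizer x₀ : Subgroup 𝒢`;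
* `RightActionData.exists_isCompact_descent` — **the descent theorem** above.
-/

open scoped Pointwise

namespace HodgeCM.PerL34.StabilizerDescent

/-- A right action of a group `𝒢` on a type `X`, as bare data. -/
structure RightActionData (𝒢 X : Type*) [Group 𝒢] where
  /-- `act x g = x · g` -/
  act : X → 𝒢 → X
  act_mul : ∀ x g h, act x (g * h) = act (act x g) h
  act_one : ∀ x, act x 1 = x

namespace RightActionData

variable {𝒢 X : Type*} [Group 𝒢] (A : RightActionData 𝒢 X)

/-- (Ported verbatim from the HodgeCMPerL package; no docstring in the source.) -/
theorem act_mul_inv_cancel (x : X) (g : 𝒢) : A.act (A.act x g) g⁻¹ = x := by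
  rw [← A.act_mul, mul_inv_cancel, A.act_one]

/-- (Ported verbatim from the HodgeCMPerL package; no docstring in the source.) -/
theorem act_inv_mul_cancel (x : X) (g : 𝒢) : A.act (A.act x g⁻¹) g = x := by
  rw [← A.act_mul, inv_mul_cancel, A.act_one]

/-- The stabiliser of a point, as a subgroup. -/
def stabilizer (x₀ : X) : Subgroup 𝒢 where
  carrier := {g | A.act x₀ g = x₀}
  one_mem' := A.act_one x₀
  mul_mem' {g h} hg hh := by
    simp only [Set.mem_setOf_eq] at hg hh ⊢
    rw [A.act_mul, hg, hh]
  inv_mem' {g} hg := by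
    simp only [Set.mem_setOf_eq] at hg ⊢
    conv_lhs => rw [← hg]
    exact A.act_mul_inv_cancel x₀ g

/-- (Ported verbatim from the HodgeCMPerL package; no docstring in the source.) -/
@[simp] theorem mem_stabilizer_iff {x₀ : X} {g : 𝒢} : g ∈ A.stabilizer x₀ ↔ A.act x₀ g = x₀ :=
  Iff.rfl

variable [TopologicalSpace 𝒢] [IsTopologicalGroup 𝒢] [TopologicalSpace X]

/-- **Descent of a compact fundamental set to a stabiliser.**  Let `𝒢` act on `X` on the right,
`x₀ ∈ X` with continuous orbit map and closed stabiliser `G`, `Γ ≤ 𝒢` a subgroup with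
`x₀ · Γ ⊆ D` for a set `D` meeting every compact subset of `X` in a finite set.  Then for every
compact `C ⊆ 𝒢` there is a compact `C′ ⊆ G` such that every `g ∈ G ∩ C · Γ` lies in
`C′ · (G ∩ Γ)`. -/
theorem exists_isCompact_descent (x₀ : X) (hcont : Continuous fun g : 𝒢 => A.act x₀ g)
    (hclosed : IsClosed (A.stabilizer x₀ : Set 𝒢)) (Γ : Subgroup 𝒢) (D : Set X)
    (hΓD : ∀ γ ∈ Γ, A.act x₀ γ ∈ D) (hfin : ∀ K : Set X, IsCompact K → (K ∩ D).Finite)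
    {C : Set 𝒢} (hC : IsCompact C) :
    ∃ C' : Set 𝒢, IsCompact C' ∧ C' ⊆ A.stabilizer x₀ ∧
      ∀ g ∈ A.stabilizer x₀, g ∈ C * (Γ : Set 𝒢) →
        g ∈ C' * ((A.stabilizer x₀ : Set 𝒢) ∩ (Γ : Set 𝒢)) := by
  classical
  -- the finite set `F = x₀ · C ∩ D`
  set F : Set X := (fun g : 𝒢 => A.act x₀ g) '' C ∩ D with hF
  have hFfin : F.Finite := hfin _ (hC.image hcont)
  -- for each point of `F` of the form `x₀ · γ⁻¹`, `γ ∈ Γ`, choose such a `γ`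
  have hchoice : ∀ y : X, ∃ γ : 𝒢, (∃ γ' ∈ Γ, A.act x₀ γ'⁻¹ = y) → (γ ∈ Γ ∧ A.act x₀ γ⁻¹ = y) := by
    intro y
    by_cases h : ∃ γ' ∈ Γ, A.act x₀ γ'⁻¹ = y
    · obtain ⟨γ', hγ', hy⟩ := h
      exact ⟨γ', fun _ => ⟨hγ', hy⟩⟩
    · exact ⟨1, fun h' => (h h').elim⟩
  choose sel hsel using hchoice
  set T : Finset 𝒢 := hFfin.toFinset.image sel with hT
  -- the compact set `C′ = G ∩ ⋃_{γ ∈ T} C γ`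
  set C' : Set 𝒢 := (A.stabilizer x₀ : Set 𝒢) ∩ ⋃ γ ∈ T, (fun c => c * γ) '' C with hC'
  have hC'c : IsCompact C' := by
    have hU : IsCompact (⋃ γ ∈ T, (fun c : 𝒢 => c * γ) '' C) :=
      T.isCompact_biUnion fun γ _ => hC.image (continuous_id.mul continuous_const)
    exact (hU.inter_left hclosed)
  refine ⟨C', hC'c, Set.inter_subset_left, ?_⟩
  intro g hg hgC
  obtain ⟨c, hc, γ, hγ, rfl⟩ := Set.mem_mul.mp hgC
  -- `y = x₀ · c = x₀ · γ⁻¹ ∈ F`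
  have hy : A.act x₀ c = A.act x₀ γ⁻¹ := by
    have : A.act x₀ (c * γ) = x₀ := hg
    calc A.act x₀ c = A.act (A.act x₀ (c * γ)) γ⁻¹ := by
            rw [A.act_mul, A.act_mul_inv_cancel]
      _ = A.act x₀ γ⁻¹ := by rw [this]
  have hyF : A.act x₀ c ∈ F := by
    refine ⟨⟨c, hc, rfl⟩, ?_⟩
    rw [hy]
    exact hΓD _ (Γ.inv_mem (SetLike.mem_coe.mp hγ))
  have hex : ∃ γ' ∈ Γ, A.act x₀ γ'⁻¹ = A.act x₀ c := ⟨γ, SetLike.mem_coe.mp hγ, hy.symm⟩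
  obtain ⟨hselΓ, hsely⟩ := hsel _ hex
  set γ₀ := sel (A.act x₀ c) with hγ₀
  have hγ₀T : γ₀ ∈ T := Finset.mem_image.mpr ⟨A.act x₀ c, hFfin.mem_toFinset.mpr hyF, rfl⟩
  -- `δ = γ₀⁻¹ γ ∈ G ∩ Γ` and `g = (c γ₀) δ`
  have hδstab : γ₀⁻¹ * γ ∈ A.stabilizer x₀ := by
    rw [mem_stabilizer_iff, A.act_mul, hsely, hy, A.act_inv_mul_cancel]
  have hδΓ : γ₀⁻¹ * γ ∈ Γ := Γ.mul_mem (Γ.inv_mem hselΓ) (SetLike.mem_coe.mp hγ)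
  have hcγ₀stab : c * γ₀ ∈ A.stabilizer x₀ := by
    have h1 : c * γ₀ = (c * γ) * (γ₀⁻¹ * γ)⁻¹ := by group
    rw [h1]
    exact (A.stabilizer x₀).mul_mem hg ((A.stabilizer x₀).inv_mem hδstab)
  refine Set.mem_mul.mpr ⟨c * γ₀, ⟨hcγ₀stab, ?_⟩, γ₀⁻¹ * γ, ⟨hδstab, hδΓ⟩, by group⟩
  exact Set.mem_biUnion hγ₀T ⟨c, hc, rfl⟩

end RightActionData

end HodgeCM.PerL34.StabilizerDescent
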